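import Summits.BirchSwinnertonDyer.BirchSwinnertonDyer.Theorems.PrintX8MazurTateThreeCollapse
import Literature.NumberTheory.EllipticCurves.Rank1Residual.CyclotomicWindingSpan
import HarnessLib

/-!
# Route `PrintX8`, crux `SharpFlatMuAnSmallImageX8` (An, stmt-BirchSwinnertonDyer-20714), LINE «layered Stevens
# at 3» (plan g5): the support LS-G `CollapseLS` as a kernel theorem — unit winding-symbol differences at TWO
# CONSECUTIVE layers `m, m+1` give BOTH colours `μ(L♯) = μ(L♭) = 0`, i.e. the Perrin-Riou–Pollack node
# `SignedMuVanishing W 3`, on every Class-X8 pair (cell `bsd-print-x8`, D-0131 (2) print tier, prover seat p3 g3;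
# `--supports` 20714, closes nothing)

PARTITION (cell bsd-print-x8, leaf `ClassX8` = `3` good supersingular with `a_3 = ±3`): this is the planner's
TURNKEY LS-G (`run/shared/lean/pub/bsd-print-x8/plan/ls/LINE-LAYERED-STEVENS-AT-3.md` §1/§7, `SketchLS.lean`
`CollapseLS W := ClassX8 W 3 → CycWindingUnitTwoLayersAt W 3 → SignedMuVanishing W 3`) PROVED, over the tree's
two-layer carrier `Rank1Residual.CycWindingUnitTwoLayersAt` (ty2 g5, p561961) and part 1 of this seat's
vertical-Stevens files (`PrintX8MazurTateThreeCollapse`, p558954).  Closes NO item (the carrier is an OPEN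
hypothesis ⟸ LS-B ⟸ LS-0 = Sun 2007 Conj. 8 at `(3,3)`), moves 0 census cells; BSD is not proved by any of
this.  THEOREMS ONLY; no definition, no named fact.  beyond-print: yes (the reduction «two certified layers ⟹
Perrin-Riou's Conj. 7.1 at `(E, 3)` on X8» as a theorem on the tree's real objects).

## The statement and proof

`ClassX8.forall_chromaticL_muZero_of_twoLayers`: `E = W` in class X8 (ANY `3`-adic image, any rank), `f` a
newform of `E` (any level), `(L♯, L♭)` ANY Sprung pair, `m ≥ 1`, `b, b' ∈ ℤ` prime to `3` with
`‖[b/3ᵐ]⁺_f − [0]⁺_f‖₃ ≥ 1` and `‖[b'/3^{m+1}]⁺_f − [0]⁺_f‖₃ ≥ 1` ⟹ for EVERY colour `•`: `L^• ≠ 0`, `μ(L^•) = 0`,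
unit content, `μ(Λ/(L^•)) = 0`.  Proof (memo §1 COLLAPSE): all symbols are `3`-integral (`a_3 ≢ 1`, Sprung 2017
Cor. 4.10); if `[0]⁺_f` is a unit, BOTH colours are units of `Λ` (`ClassX8.isUnit_chromaticL`, Kurihara);
otherwise `‖[0]⁺‖ < 1` and the two differences force `[b/3ᵐ]⁺`, `[b'/3^{m+1}]⁺` to be units (ultrametric), so by
the collapse lemma `red_ne_zero_of_mazurTate_of_norm_ratPlusSymbol_eq_one` (part 1) the integral models of
`θ_{m−1}` and `θ_m` are `≢ 0 (mod 3)` — one index odd, one even — and the two-layer reading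
`forall_chromaticL_muZero_of_mazurTate_odd_even` (p546221) gives both colours.  Corollaries: from the carrier
`CycWindingUnitTwoLayersAt W p` (`…_of_cycWindingUnitTwoLayersAt`), the node `SignedMuVanishing W p`
(`ClassX8.signedMuVanishing_of_cycWindingUnitTwoLayersAt`), `collapseLS` (= `CollapseLS W` verbatim), and the road
glue `signedMuVanishing_of_bridgeLS_of_layerEisSpanTwo` (LS-0₂ at the level + the bridge LS-B, both taken as
hypotheses in the spelling of `SketchLS.lean`, ⟹ the node on X8).  The all-level form (no Carayol level
transport needed) is what the route item 20714 An quantifies; its by-name form is in the sibling file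
`PrintX8LayeredStevens.lean`.

References: [Pollack2003] Def. 6.15, Prop. 6.9–6.10; [Sprung2017] §3.1, Cor. 4.4, Cor. 4.10, Thm. 1.12;
[PerrinRiou2003] §6.1 Conj. 6.1.1; [Kurihara2002] Thm. 0.1; [Sun2007] §4 Conj. 8; [MazurTateTeitelbaum1986Invent]
§I.4 (4.2), §I.8, §I.10; files `Theorems/PrintX8MazurTateThreeCollapse.lean` (p558954),
`Theorems/PrintX8MazurTateMuRider.lean` (p546221), `Rank1Residual/Supersingular/SignedMuVanishing.lean`,
`Literature/…/Rank1Residual/CyclotomicWindingSpan.lean` (p557383/p561961), planner memo + `SketchLS.lean` (plan g5).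
-/

set_option autoImplicit false
-- justification: the mandated namespace `Summit.BirchSwinnertonDyer.BirchSwinnertonDyer.Theorems`
-- (single-conjunct summit, Sub = Summit) repeats a segment by design (D-0017).
set_option linter.dupNamespace false

noncomputable section

open scoped Classical MatrixGroups ModularForm

open CongruenceSubgroup Polynomial WeierstrassCurve Literature.NumberTheory.EllipticCurves
  Literature.NumberTheory.EllipticCurves.ModularForms
  Literature.NumberTheory.EllipticCurves.Sprung2017
  Literature.NumberTheory.EllipticCurves.Rank1Residual
  Literature.NumberTheory.EllipticCurves.GreenbergVatsal2000
  Summit.BirchSwinnertonDyer.Rank1Residual.X1.MuLambda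
  Summit.BirchSwinnertonDyer.Rank1Residual.Supersingular
  Summit.BirchSwinnertonDyer.BirchSwinnertonDyer.Theorems.PrintX8MazurTateMuRider
  Summit.BirchSwinnertonDyer.BirchSwinnertonDyer.Theorems.PrintX8MazurTateThreeCollapse

namespace Summit.BirchSwinnertonDyer.BirchSwinnertonDyer.Theorems.PrintX8LayeredStevensCollapse

/-! ### §1. Two small tools: integer numerators at an exact layer; the ultrametric pinch -/

section Tools

variable {N : ℕ} [NeZero N] (f : CuspForm (Gamma0 N) 2) (p : ℕ) [hp : Fact p.Prime]

/-- Periodicity for integer numerators at a FIXED level: `[b/pᴸ]⁺_f = [(b mod pᴸ)/pᴸ]⁺_f` with the natural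
representative `(b : ZMod pᴸ).val`. [cite: MazurTateTeitelbaum1986Invent, §I.4 (4.2)] -/
theorem ratPlusSymbol_intCast_div_pow_eq_val (L : ℕ) (b : ℤ) :
    ratPlusSymbol f ((b : ℚ) / (p : ℚ) ^ L) =
      ratPlusSymbol f (((b : ZMod (p ^ L)).val : ℚ) / (p : ℚ) ^ L) := by
  haveI : NeZero (p ^ L) := ⟨pow_ne_zero _ hp.out.ne_zero⟩
  have hp0 : (p : ℚ) ^ L ≠ 0 := pow_ne_zero _ (Nat.cast_ne_zero.mpr hp.out.ne_zero)
  set M : ℤ := ((p ^ L : ℕ) : ℤ) with hM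
  have hval : (((b : ZMod (p ^ L)).val : ℕ) : ℤ) = b % M := ZMod.val_intCast b
  have hdiv : b % M + M * (b / M) = b := Int.emod_add_mul_ediv b M
  have hb : (b : ℚ) = (((b : ZMod (p ^ L)).val : ℕ) : ℚ) + (p : ℚ) ^ L * ((b / M : ℤ) : ℚ) := by
    have h : b = (((b : ZMod (p ^ L)).val : ℕ) : ℤ) + M * (b / M) := by rw [hval]; exact hdiv.symm
    have h' := congr_arg (Int.cast : ℤ → ℚ) h
    rw [hM] at h'
    push_cast at h'
    exact h'
  have e : (b : ℚ) / (p : ℚ) ^ L =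
      (((b : ZMod (p ^ L)).val : ℕ) : ℚ) / (p : ℚ) ^ L + ((b / M : ℤ) : ℚ) := by
    rw [hb]
    field_simp
  rw [e, ratPlusSymbol_add_intCast_eq]

omit [NeZero N] in
/-- If `p ∤ b` then `p ∤ (b mod pᴸ)` for `L ≥ 1`. [folklore] -/
theorem not_dvd_val_intCast {L : ℕ} (hL : 1 ≤ L) {b : ℤ} (hb : ¬ (p : ℤ) ∣ b) :
    ¬ p ∣ (b : ZMod (p ^ L)).val := by
  haveI : NeZero (p ^ L) := ⟨pow_ne_zero _ hp.out.ne_zero⟩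
  intro h
  apply hb
  set M : ℤ := ((p ^ L : ℕ) : ℤ) with hM
  have hval : (((b : ZMod (p ^ L)).val : ℕ) : ℤ) = b % M := ZMod.val_intCast b
  have h1 : (p : ℤ) ∣ b % M := by
    rw [← hval]
    exact_mod_cast h
  have h2 : (p : ℤ) ∣ M := by
    rw [hM]
    push_cast
    exact dvd_pow_self (p : ℤ) (by omega)
  rw [← Int.emod_add_mul_ediv b M]
  exact dvd_add h1 (dvd_mul_of_dvd_left h2 _)

omit [NeZero N] in
/-- Ultrametric pinch: `‖x‖ ≤ 1`, `‖y‖ < 1`, `‖x − y‖ ≥ 1` ⟹ `‖x‖ = 1`. [folklore] -/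
theorem norm_eq_one_of_one_le_norm_sub {x y : ℚ_[p]} (hx : ‖x‖ ≤ 1) (hy : ‖y‖ < 1)
    (hxy : 1 ≤ ‖x - y‖) : ‖x‖ = 1 := by
  refine le_antisymm hx (not_lt.mp fun hlt ↦ ?_)
  have h := Padic.nonarchimedean x (-y)
  rw [norm_neg, ← sub_eq_add_neg] at h
  exact absurd (hxy.trans h) (not_le.mpr (max_lt hlt hy))

end Tools

/-! ### §2. Class X8: two consecutive layers ⟹ BOTH colours -/

section TwoLayers

variable {W : WeierstrassCurve ℚ} [W.IsElliptic] [W.IsGloballyMinimal] {N : ℕ} [NeZero N]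
  {f : CuspForm (Gamma0 N) 2} {p : ℕ} [hp : Fact p.Prime]

/-- **THE COLLAPSE AT TWO LAYERS (Class X8, any image, any rank, `f` any newform of `E`, ANY Sprung pair).**
If `m ≥ 1` and `b, b' ∈ ℤ` prime to `3` have `‖[b/3ᵐ]⁺_f − [0]⁺_f‖₃ ≥ 1` and `‖[b'/3^{m+1}]⁺_f − [0]⁺_f‖₃ ≥ 1`,
then EVERY colour `• ∈ {♯, ♭}` has `L^• ≠ 0`, `μ(L^•) = 0`, unit content and `μ(Λ/(L^•)) = 0`.
Unit case `ord₃[0]⁺ = 0` ⟹ both colours are units (`ClassX8.isUnit_chromaticL`); otherwise both layer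
symbols are units ⟹ `red Θ_{m−1} ≠ 0`, `red Θ_m ≠ 0` (part 1's collapse lemma) — one odd, one even index —
⟹ `forall_chromaticL_muZero_of_mazurTate_odd_even`. [cite: Pollack2003, Def. 6.15, Prop. 6.9 and Prop. 6.10]
[cite: Sprung2017, §3.1, Cor. 4.4, Cor. 4.10 and Thm. 1.12] [cite: Kurihara2002, Thm. 0.1] -/
theorem ClassX8.forall_chromaticL_muZero_of_twoLayers (hX : ClassX8 W p) (hf : IsNewformOf W f)
    {Lsharp Lflat : IwasawaAlgebra p} (hSP : IsSprungPair f p (W.frobeniusTrace p) Lsharp Lflat)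
    {m : ℕ} (hm : 1 ≤ m) {b b' : ℤ} (hb : ¬ (p : ℤ) ∣ b) (hb' : ¬ (p : ℤ) ∣ b')
    (h1 : 1 ≤ ‖((ratPlusSymbol f ((b : ℚ) / (p : ℚ) ^ m) - ratPlusSymbol f 0 : ℚ) : ℚ_[p])‖)
    (h2 : 1 ≤ ‖((ratPlusSymbol f ((b' : ℚ) / (p : ℚ) ^ (m + 1)) - ratPlusSymbol f 0 : ℚ) : ℚ_[p])‖)
    (c : Chroma) :
    chromaticL c Lsharp Lflat ≠ 0 ∧ mu (chromaticL c Lsharp Lflat) = 0 ∧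
      HasUnitContent (chromaticL c Lsharp Lflat) ∧
      muInvariant p (IwasawaAlgebra p ⧸ Ideal.span {chromaticL c Lsharp Lflat}) = 0 := by
  -- it suffices to produce `red L^• ≠ 0`
  suffices hred : red (chromaticL c Lsharp Lflat) ≠ 0 from
    ⟨ne_zero_of_red_ne_zero hred, (mu_eq_zero_and_lam_eq_of_red_ne_zero hred).1,
      hasUnitContent_of_red_ne_zero hred, muInvariant_quotient_span_eq_zero_of_red_ne_zero hred⟩
  have hX' := hX
  obtain ⟨hp3, hss, -⟩ := hX
  subst hp3
  have hp2 : (3 : ℕ) ≠ 2 := by decide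
  have hgood : W.HasGoodReductionAtPrime 3 := hss.1
  have hap3 : ((3 : ℕ) : ℤ) ∣ W.frobeniusTrace 3 := hss.2
  have hf0 : IsNewform0 f := hf.1
  have hpN : ¬ 3 ∣ N := not_dvd_level_of_isNewformOf hf hgood
  have hap : cuspCoeff f 3 = ((W.frobeniusTrace 3 : ℤ) : ℂ) :=
    cuspCoeff_eq_frobeniusTrace_of_isNewformOf_holds hf hgood
  have hpa : ¬ ((3 : ℕ) : ℤ) ∣ W.frobeniusTrace 3 - 1 := by
    intro h
    have h' : ((3 : ℕ) : ℤ) ∣ W.frobeniusTrace 3 - (W.frobeniusTrace 3 - 1) := dvd_sub hap3 h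
    rw [sub_sub_cancel] at h'
    norm_num at h'
  have he : cyclotomicExponent 3 = 1 := if_neg hp2
  by_cases h0 : ‖((ratPlusSymbol f 0 : ℚ) : ℚ_[3])‖ = 1
  · -- the unit case: both colours are units of `Λ`
    have hr : ratPlusSymbol f 0 ≠ 0 := by
      intro hz
      rw [hz, Rat.cast_zero, norm_zero] at h0
      exact zero_ne_one h0
    have hv : padicValRat 3 (ratPlusSymbol f 0) = 0 := by
      rw [Padic.eq_padicNorm, padicNorm.eq_zpow_of_nonzero hr] at h0
      have h0' : ((3 : ℚ) ^ (-padicValRat 3 (ratPlusSymbol f 0)) : ℚ) = 1 := by exact_mod_cast h0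
      have h3 := (zpow_eq_one_iff_right₀ (by norm_num : (0 : ℚ) ≤ 3) (by norm_num : (3 : ℚ) ≠ 1)).mp h0'
      omega
    exact ((ClassX8.isUnit_chromaticL hX' hf hSP c hr hv).map
      (PowerSeries.map (IsLocalRing.residue ℤ_[3]))).ne_zero
  · -- both layer symbols are units
    have h0lt : ‖((ratPlusSymbol f 0 : ℚ) : ℚ_[3])‖ < 1 := by
      refine lt_of_le_of_ne ?_ h0
      have h := norm_ratPlusSymbol_div_pow_le_one_of_not_dvd hp2 hf0 hpN hap hpa 0 0
      simpa using h
    -- layer `m`: the symbol `[b/3ᵐ]⁺`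
    have hu1 : ‖((ratPlusSymbol f ((((b : ZMod (3 ^ m)).val : ℕ) : ℚ) / ((3 : ℕ) : ℚ) ^ m) : ℚ) :
        ℚ_[3])‖ = 1 := by
      rw [← ratPlusSymbol_intCast_div_pow_eq_val f 3 m b]
      rw [Rat.cast_sub] at h1
      exact norm_eq_one_of_one_le_norm_sub 3
        (by rw [ratPlusSymbol_intCast_div_pow_eq_val f 3 m b]
            exact norm_ratPlusSymbol_div_pow_le_one_of_not_dvd hp2 hf0 hpN hap hpa _ _) h0lt h1
    -- layer `m + 1`: the symbol `[b'/3^{m+1}]⁺`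
    have hu2 : ‖((ratPlusSymbol f ((((b' : ZMod (3 ^ (m + 1))).val : ℕ) : ℚ) /
        ((3 : ℕ) : ℚ) ^ (m + 1)) : ℚ) : ℚ_[3])‖ = 1 := by
      rw [← ratPlusSymbol_intCast_div_pow_eq_val f 3 (m + 1) b']
      rw [Rat.cast_sub] at h2
      exact norm_eq_one_of_one_le_norm_sub 3
        (by rw [ratPlusSymbol_intCast_div_pow_eq_val f 3 (m + 1) b']
            exact norm_ratPlusSymbol_div_pow_le_one_of_not_dvd hp2 hf0 hpN hap hpa _ _) h0lt h2
    -- integral models of `θ_{m-1}` and `θ_m`, both `≢ 0 (mod 3)`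
    obtain ⟨n, rfl⟩ : ∃ n, m = n + 1 := ⟨m - 1, by omega⟩
    obtain ⟨P₁, hP₁⟩ := exists_map_eq_map_mazurTateElement_of_not_dvd hp2 hf0 hpN hap hpa n
    obtain ⟨P₂, hP₂⟩ := exists_map_eq_map_mazurTateElement_of_not_dvd hp2 hf0 hpN hap hpa (n + 1)
    have hΘ₁ : iwasawaToPowerSeries 3 (P₁ : PowerSeries ℤ_[3]) =
        ((mazurTateElement f 3 n).map (algebraMap ℚ ℚ_[3]) : PowerSeries ℚ_[3]) := by
      rw [← hP₁, Polynomial.polynomial_map_coe]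
    have hΘ₂ : iwasawaToPowerSeries 3 (P₂ : PowerSeries ℤ_[3]) =
        ((mazurTateElement f 3 (n + 1)).map (algebraMap ℚ ℚ_[3]) : PowerSeries ℚ_[3]) := by
      rw [← hP₂, Polynomial.polynomial_map_coe]
    have hred₁ : red (P₁ : PowerSeries ℤ_[3]) ≠ 0 :=
      red_ne_zero_of_mazurTate_of_norm_ratPlusSymbol_eq_one f rfl hf0 hpN hap hpa hΘ₁
        (not_dvd_val_intCast 3 (L := n + 1) (by omega) hb) (by rw [he]; exact hu1)
    have hred₂ : red (P₂ : PowerSeries ℤ_[3]) ≠ 0 :=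
      red_ne_zero_of_mazurTate_of_norm_ratPlusSymbol_eq_one f rfl hf0 hpN hap hpa hΘ₂
        (not_dvd_val_intCast 3 (L := n + 1 + 1) (by omega) hb') (by rw [he]; exact hu2)
    have hΘ₁0 := ne_zero_of_red_ne_zero hred₁
    have hμ₁ := (mu_eq_zero_and_lam_eq_of_red_ne_zero hred₁).1
    have hΘ₂0 := ne_zero_of_red_ne_zero hred₂
    have hμ₂ := (mu_eq_zero_and_lam_eq_of_red_ne_zero hred₂).1
    -- one of `n`, `n + 1` is odd, the other even
    have key : ∀ c' : Chroma, chromaticL c' Lsharp Lflat ≠ 0 ∧ mu (chromaticL c' Lsharp Lflat) = 0 ∧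
        HasUnitContent (chromaticL c' Lsharp Lflat) ∧
        muInvariant 3 (IwasawaAlgebra 3 ⧸ Ideal.span {chromaticL c' Lsharp Lflat}) = 0 := by
      intro c'
      rcases Nat.even_or_odd n with hn | hn
      · have hn1 : Odd (n + 1) := hn.add_one
        exact forall_chromaticL_muZero_of_mazurTate_odd_even hp2 hf hgood hap3 hSP hn1 hn hΘ₂ hΘ₂0 hμ₂
          hΘ₁ hΘ₁0 hμ₁ c'
      · have hn1 : Even (n + 1) := hn.add_one
        exact forall_chromaticL_muZero_of_mazurTate_odd_even hp2 hf hgood hap3 hSP hn hn1 hΘ₁ hΘ₁0 hμ₁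
          hΘ₂ hΘ₂0 hμ₂ c'
    obtain ⟨hne, hmu, -, -⟩ := key c
    exact red_ne_zero_of_mu_eq_zero hne hmu

/-- **Class X8: the two-layer carrier `CycWindingUnitTwoLayersAt W p` ⟹ both colours at every newform and every
Sprung pair** (all four currencies). [cite: Pollack2003, Def. 6.15, Prop. 6.9 and Prop. 6.10]
[cite: Sprung2017, Cor. 4.10 and Thm. 1.12] [cite: PerrinRiou2003, §6.1 Conjecture 6.1.1] -/
theorem ClassX8.forall_chromaticL_muZero_of_cycWindingUnitTwoLayersAt (hX : ClassX8 W p)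
    (hLS : CycWindingUnitTwoLayersAt W p) (hf : IsNewformOf W f)
    {Lsharp Lflat : IwasawaAlgebra p} (hSP : IsSprungPair f p (W.frobeniusTrace p) Lsharp Lflat)
    (c : Chroma) :
    chromaticL c Lsharp Lflat ≠ 0 ∧ mu (chromaticL c Lsharp Lflat) = 0 ∧
      HasUnitContent (chromaticL c Lsharp Lflat) ∧
      muInvariant p (IwasawaAlgebra p ⧸ Ideal.span {chromaticL c Lsharp Lflat}) = 0 := by
  obtain ⟨m, b, b', hm, hb, hb', h1, h2⟩ := hLS f hf
  exact ClassX8.forall_chromaticL_muZero_of_twoLayers hX hf hSP hm hb hb' h1 h2 c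

/-- **Class X8: `CycWindingUnitTwoLayersAt W p` ⟹ the Perrin-Riou–Pollack node `SignedMuVanishing W p`**
(both colours non-zero with `μ = 0`, for the newform at the conductor level and every Sprung pair).
[cite: PerrinRiou2003, §6.1 Conjecture 6.1.1] [cite: Pollack2003, Prop. 6.9 and Prop. 6.10] [cite: Sprung2017, Cor. 4.10 and Thm. 1.12] -/
theorem ClassX8.signedMuVanishing_of_cycWindingUnitTwoLayersAt (hX : ClassX8 W p)
    (hLS : CycWindingUnitTwoLayersAt W p) : SignedMuVanishing W p := by
  intro hN f₀ hf₀ Lsharp Lflat hSP c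
  haveI := hN
  obtain ⟨hne, hmu, -, -⟩ :=
    ClassX8.forall_chromaticL_muZero_of_cycWindingUnitTwoLayersAt hX hLS hf₀ hSP c
  exact ⟨hne, hmu⟩

end TwoLayers

/-! ### §3. The turnkey signature `CollapseLS W` verbatim, and the road glue -/

section Collapse

variable (W : WeierstrassCurve ℚ) [W.IsElliptic] [W.IsGloballyMinimal]

/-- **LS-G `CollapseLS W` (planner sketch `plan/ls/SketchLS.lean`, VERBATIM): `ClassX8 W 3 →
CycWindingUnitTwoLayersAt W 3 → SignedMuVanishing W 3`.** [cite: PerrinRiou2003, §6.1 Conjecture 6.1.1]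
[cite: Sun2007, §4 Conj. 8] [cite: Sprung2017, Cor. 4.10 and Thm. 1.12] -/
theorem collapseLS : ClassX8 W 3 → CycWindingUnitTwoLayersAt W 3 → SignedMuVanishing W 3 :=
  fun hX hLS ↦ ClassX8.signedMuVanishing_of_cycWindingUnitTwoLayersAt hX hLS

variable {W} {p : ℕ} [hp : Fact p.Prime]

/-- **Road glue on X8: LS-0₂ at the levels of the newforms of `W` + the bridge LS-B ⟹ `SignedMuVanishing W p`**,
with LS-B taken as a hypothesis in the spelling `BridgeLS W p` of `SketchLS.lean` (the bridge is seat p1's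
turnkey) and LS-G discharged by this file; `a_p ≢ 1 (mod p)` is automatic on X8 (`a_3 = ±3`).
[cite: Sun2007, §4 Conj. 8] [cite: PerrinRiou2003, §6.1 Conjecture 6.1.1] -/
theorem ClassX8.signedMuVanishing_of_bridgeLS_of_layerEisSpanTwo (hX : ClassX8 W p)
    (hB : (∀ {N : ℕ} [NeZero N] (f : CuspForm (Gamma0 N) 2), IsNewformOf W f → LayerEisSpanTwoModGen N p) →
      ¬ ((p : ℤ) ∣ W.frobeniusTrace p - 1) → CycWindingUnitTwoLayersAt W p)
    (hLS0 : ∀ {N : ℕ} [NeZero N] (f : CuspForm (Gamma0 N) 2), IsNewformOf W f → LayerEisSpanTwoModGen N p) :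
    SignedMuVanishing W p := by
  have hpa : ¬ ((p : ℤ) ∣ W.frobeniusTrace p - 1) := by
    obtain ⟨hp3, hss, -⟩ := hX
    subst hp3
    intro h
    have h' : ((3 : ℕ) : ℤ) ∣ W.frobeniusTrace 3 - (W.frobeniusTrace 3 - 1) := dvd_sub hss.2 h
    rw [sub_sub_cancel] at h'
    norm_num at h'
  have hLS : CycWindingUnitTwoLayersAt W p := hB (fun f hf ↦ hLS0 f hf) hpa
  intro hN f₀ hf₀ Lsharp Lflat hSP c
  haveI := hN
  exact ClassX8.signedMuVanishing_of_cycWindingUnitTwoLayersAt hX hLS f₀ hf₀ Lsharp Lflat hSP c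

/-- **LS-0(p) class form ⟹ the node on X8**, modulo the bridge: if every level `N ≥ 1` prime to `p` has
LAYER-EIS-SPAN mod `p` at all layers `m ≥ m₀(N)` (`LayeredStevensModAt p` of `SketchLS.lean`, spelled out; =
Sun 2007 Conj. 8 at `(p,p)` mod `p`, Eisenstein-refined — an OPEN conjecture, here a HYPOTHESIS), then with LS-B
every Class-X8 curve satisfies `SignedMuVanishing W p` (`3 ∤ N` for the levels of newforms of `W` from good
reduction at `3`, `not_dvd_level_of_isNewformOf`). [cite: Sun2007, §4 Conj. 8] [cite: PerrinRiou2003, §6.1 Conjecture 6.1.1] -/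
theorem ClassX8.signedMuVanishing_of_bridgeLS_of_layeredStevens (hX : ClassX8 W p)
    (hB : (∀ {N : ℕ} [NeZero N] (f : CuspForm (Gamma0 N) 2), IsNewformOf W f → LayerEisSpanTwoModGen N p) →
      ¬ ((p : ℤ) ∣ W.frobeniusTrace p - 1) → CycWindingUnitTwoLayersAt W p)
    (hLSM : ∀ N : ℕ, 0 < N → ¬ p ∣ N → ∃ m₀ : ℕ, ∀ m : ℕ, m₀ ≤ m → LayerEisSpanModGen N p m) :
    SignedMuVanishing W p := by
  have hgood : W.HasGoodReductionAtPrime p := by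
    obtain ⟨hp3, hss, -⟩ := hX
    subst hp3
    exact hss.1
  have hLS0 : ∀ {N : ℕ} [NeZero N] (f : CuspForm (Gamma0 N) 2), IsNewformOf W f →
      LayerEisSpanTwoModGen N p := by
    intro N _ f hf
    obtain ⟨m₀, hm₀⟩ := hLSM N (Nat.pos_of_ne_zero (NeZero.ne N)) (not_dvd_level_of_isNewformOf hf hgood)
    exact ⟨m₀ + 1, by omega, hm₀ _ (by omega), hm₀ _ (by omega)⟩
  intro hN f₀ hf₀ Lsharp Lflat hSP c
  haveI := hN
  exact ClassX8.signedMuVanishing_of_bridgeLS_of_layerEisSpanTwo hX hB (fun f hf ↦ hLS0 f hf) f₀ hf₀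
    Lsharp Lflat hSP c

end Collapse

end Summit.BirchSwinnertonDyer.BirchSwinnertonDyer.Theorems.PrintX8LayeredStevensCollapse

end
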